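import Summits.QuantumFields.YangMills.Theorems.PencilRigidityShellRigidityThalesGlue

/-!
# `SoftKernelBoostCovariance` — negative-side support II: the index-locked dimension-4 composite is NOT diagonally
reflection positive (explicit three-point certificate)

Support file for crux `stmt-QuantumFields-14999` (refuter, cdisprove; work file
`Cruxes/SoftKernelBoostCovariance/Disproof.lean` §5 (iii)).  Context: a model-blind counterexample to the
level step of the picked line (or to the model-blind core of the crux below the `|x|⁻¹⁰` threshold) needs an
anisotropic `W(B₄)`-symmetric species with a SOFT two-point kernel that is reflection positive across the axis
AND the diagonal mirrors of a coordinate plane.  Honest `W(B₄)`-scalar Wick polynomials of scalar free fields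
reach anisotropy only at dimension `≥ 5`; the one dimension-4 candidate is INTERNAL-INDEX LOCKING,
`s = Σ_μ :(∂_μ φ_μ)²:` for four i.i.d. massless free scalars `φ_μ` (`W(B₄)` acting by relabelling), whose
two-point function is `2 (4π²)⁻² · K`,
`K(x) = Σ_μ (∂_μ² |x|⁻²)² = Σ_μ ((8x_μ² − 2|x|²)/|x|⁶)² = 16 (4Σ_μ x_μ⁴ − |x|⁴)/|x|¹²` — `W(B₄)`-invariant,
continuous off `0`, `0 ≤ K ≤ 48|x|⁻⁸` (soft, `η = 2`), axis-mirror RP (each `:(∂_μφ_μ)²:` is reflection-even;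
Schur products), and NOT radial.  By the landed `ShellRigidity_proof` it must therefore violate reflection
positivity across the diagonal mirror `x₀ ↔ x₁`; this file exhibits the violation EXPLICITLY, in exactly the
matrix form `hdiag` of `PencilRigidity.ShellRigidity`: three points `(2,0,0,0), (3,1,0,0), (4,2,0,0)` of the
half-space `x₁ < x₀` and coefficients `(1, −1, 1)` give `Σ c_i c_j K(ρx_i − x_j) = −45069/32000000 < 0`.
So the index-locked composite is not eight-frame RP already at the two-point level: relabelling involutions do
not preserve E2 (the OS form becomes `‖F₊‖² − ‖F₋‖²`), and this construction class is closed for the crux and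
its line.
-/

noncomputable section

namespace Summit.QuantumFields.YangMills.Theorems.SoftKernelBoostCovariance.Negative

open scoped BigOperators

/-- **The index-locked kernel** `K(x) = Σ_μ ((8x_μ² − 2|x|²)/|x|⁶)²` (`= Σ_μ (∂_μ²|x|⁻²)²`, the two-point
function of `Σ_μ :(∂_μφ_μ)²:` up to the factor `2(4π²)⁻²`). -/
def lockKernel (x : EuclideanSpace ℝ (Fin 4)) : ℝ :=
  ∑ μ : Fin 4, ((8 * x μ ^ 2 - 2 * ∑ ν : Fin 4, x ν ^ 2) / (∑ ν : Fin 4, x ν ^ 2) ^ 3) ^ 2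

/-- **Reflection positivity across the diagonal mirror `x₀ = x₁` in matrix form** — verbatim the hypothesis
`hdiag` of `PencilRigidity.ShellRigidity` for a kernel `K`. -/
def DiagRP (K : EuclideanSpace ℝ (Fin 4) → ℝ) : Prop :=
  ∀ (m : ℕ) (x : Fin m → EuclideanSpace ℝ (Fin 4)) (c : Fin m → ℝ), (∀ i, x i 1 < x i 0) →
    0 ≤ ∑ i, ∑ j, c i * c j * K (LinearIsometryEquiv.piLpCongrLeft 2 ℝ ℝ (Equiv.swap (0 : Fin 4) 1) (x i) - x j)

/-- The three witness points `(2,0,0,0), (3,1,0,0), (4,2,0,0)` (a tangential chain at normal distance `√2`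
from the mirror). -/
def lockPt : Fin 3 → EuclideanSpace ℝ (Fin 4) :=
  ![(2 : ℝ) • EuclideanSpace.single 0 1,
    (3 : ℝ) • EuclideanSpace.single 0 1 + EuclideanSpace.single 1 1,
    (4 : ℝ) • EuclideanSpace.single 0 1 + (2 : ℝ) • EuclideanSpace.single 1 1]

/-- Coordinates of the two basis vectors used. -/
theorem single_coords :
    (EuclideanSpace.single (0 : Fin 4) (1 : ℝ) : EuclideanSpace ℝ (Fin 4)) 0 = 1 ∧
    (EuclideanSpace.single (0 : Fin 4) (1 : ℝ) : EuclideanSpace ℝ (Fin 4)) 1 = 0 ∧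
    (EuclideanSpace.single (0 : Fin 4) (1 : ℝ) : EuclideanSpace ℝ (Fin 4)) 2 = 0 ∧
    (EuclideanSpace.single (0 : Fin 4) (1 : ℝ) : EuclideanSpace ℝ (Fin 4)) 3 = 0 ∧
    (EuclideanSpace.single (1 : Fin 4) (1 : ℝ) : EuclideanSpace ℝ (Fin 4)) 0 = 0 ∧
    (EuclideanSpace.single (1 : Fin 4) (1 : ℝ) : EuclideanSpace ℝ (Fin 4)) 1 = 1 ∧
    (EuclideanSpace.single (1 : Fin 4) (1 : ℝ) : EuclideanSpace ℝ (Fin 4)) 2 = 0 ∧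
    (EuclideanSpace.single (1 : Fin 4) (1 : ℝ) : EuclideanSpace ℝ (Fin 4)) 3 = 0 := by
  simp

/-- The witness coefficients `(1, −1, 1)`. -/
def lockCoeff : Fin 3 → ℝ := ![1, -1, 1]

/-- **Theorem (explicit certificate).**  The index-locked kernel violates diagonal reflection positivity:
`Σ_{i,j} c_i c_j K(ρ x_i − x_j) = −45069/32000000` for the witness above. -/
theorem lockKernel_not_diagRP : ¬ DiagRP lockKernel := by
  intro h
  have hx : ∀ i : Fin 3, lockPt i 1 < lockPt i 0 := by
    intro i
    fin_cases i <;> norm_num [lockPt]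
  have key := h 3 lockPt lockCoeff hx
  revert key
  rw [imp_false, not_le]
  have s2 : Equiv.swap (0 : Fin 4) 1 2 = 2 := by decide
  have s3 : Equiv.swap (0 : Fin 4) 1 3 = 3 := by decide
  obtain ⟨a0, a1, a2, a3, b0, b1, b2, b3⟩ := single_coords
  simp only [Fin.sum_univ_three, Fin.sum_univ_four, lockKernel, lockCoeff, lockPt, PiLp.sub_apply, PiLp.add_apply,
    PiLp.smul_apply, smul_eq_mul,
    Summit.QuantumFields.YangMills.Cruxes.ShellRigidity.ThalesSlitExactConeType.swap01_apply,
    Equiv.swap_apply_left, Equiv.swap_apply_right, s2, s3,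
    a0, a1, a2, a3, b0, b1, b2, b3, Matrix.cons_val_zero, Matrix.cons_val_one, Matrix.head_cons,
    Matrix.cons_val_two, Matrix.tail_cons]
  norm_num
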